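import Summits.CriticalPhenomena.PercolationContinuityZ3.Theorems.Transplant.FreeSubmonoidExpGrowth
import HarnessLib

/-!
# `θ(p_c) = 0` on EVERY Cayley graph of the SOL lattice `ℤ² ⋊_B ℤ`, `B = (2 1; 1 1)` — a POLYCYCLIC, non-virtually-nilpotent group with `b₁ = 1`,
# as a concrete kernel customer of the exponential-growth row (unconditional)

builds on p205010 (kernel theorem, internal audit signed; external expert review pending) — nothing in this file uses p205010; unconditional, no node.
Lane `prim-bschramm`, seat `prim-bschramm-p4` gen 23 (PART C3 of `P4-GENERAL.md` §45).  Helper file (`--supports stmt-CriticalPhenomena-4575 --as helper`).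

THE POINT.  The exponential-growth row of the class map had as concrete kernel customers free groups, lamplighters and `BS(1,2)` (gen 22) — none of
them polycyclic.  By Milnor–Wolf every polycyclic group is virtually nilpotent or of exponential growth; the simplest polycyclic group that is NOT
virtually nilpotent is the lattice `Γ_B = ℤ² ⋊_B ℤ` of the Lie group Sol for a hyperbolic `B ∈ SL₂(ℤ)`.  Here `B = (2 1; 1 1)` (the square of the
Fibonacci matrix), realised faithfully as the affine group **`SolB.Grp = ⟨p ↦ Bp, p ↦ p + e₁⟩ ≤ Perm(ℤ × ℤ)`**.  It has `b₁ = 1` (`det(B − I) = −1`,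
so `H₁ = ℤ`) and the same holds for all its finite-index subgroups — it is NOT on the wall and NOT reachable by any chart-based theorem; it contains
`ℤ²` (so `p_c < 1` by `CayleyZSq`), and it has exponential growth, certified here by a FREE PAIR: the affine maps `u : p ↦ Bp` and `v : p ↦ Bp + e₁`
generate a free submonoid — a positive word `w` acts by `p ↦ B^{|w|} p + c_w` with `c_w = Σ_{wᵢ = v} Bⁱ e₁` (`posWord_apply`), and the "digits" are
recovered because the sums `ℓ(Bⁱ e₁)` (`ℓ(x, y) = x + y`: `1, 3, 8, 21, …`) grow by a factor `≥ 2` (`cvec_le_svec`, `svec_lt_bpow`, `cvec_injective`).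
Hence (`FreePair.criticalContinuity`, gen 22): **`SolB.criticalContinuity_anyGens` — for every finite generating set `S` of `Γ_B` and every vertex,
`θ_g(p_c(Cay(Γ_B; S))) = 0`**, unconditionally; `SolB.hasExponentialGrowth_anyGens`.
[cite: MilnorSolvableGrowth1968, p. 447 (free semigroups; solvable groups of exponential growth)] [cite: LyonsPeres2016, §7.4 Thm. 7.20]
[cite: Hutchcroft2016, Thm. 1] [cite: BenjaminiSchramm1996, Conj. 4; §2 (Cayley graphs)]
-/

noncomputable section

namespace Summit.CriticalPhenomena.PercolationContinuityZ3.Theorems.Transplant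
open SimpleGraph Literature.Probability.LatticeModels Literature.Probability.Percolation
open scoped Classical

namespace SolB

/-- `p ↦ Bp`, `B = (2 1; 1 1)` (inverse `(1 −1; −1 2)`). [folklore] -/
def shear : Equiv.Perm (ℤ × ℤ) where
  toFun p := (2 * p.1 + p.2, p.1 + p.2)
  invFun p := (p.1 - p.2, 2 * p.2 - p.1)
  left_inv p := by ext <;> simp only <;> ring
  right_inv p := by ext <;> simp only <;> ring

/-- `p ↦ p + e₁`. [folklore] -/
def transl : Equiv.Perm (ℤ × ℤ) where
  toFun p := (p.1 + 1, p.2)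
  invFun p := (p.1 - 1, p.2)
  left_inv p := by ext <;> simp
  right_inv p := by ext <;> simp

/-- `p ↦ Bp + e₁ = transl ∘ shear`. [folklore] -/
def shearTransl : Equiv.Perm (ℤ × ℤ) := transl * shear

/-- `shear (x, y) = (2x + y, x + y)`. [folklore] -/
@[simp] theorem shear_apply (p : ℤ × ℤ) : shear p = (2 * p.1 + p.2, p.1 + p.2) := rfl
/-- `transl (x, y) = (x + 1, y)`. [folklore] -/
@[simp] theorem transl_apply (p : ℤ × ℤ) : transl p = (p.1 + 1, p.2) := rfl
/-- `shearTransl (x, y) = (2x + y + 1, x + y)`. [folklore] -/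
@[simp] theorem shearTransl_apply (p : ℤ × ℤ) : shearTransl p = (2 * p.1 + p.2 + 1, p.1 + p.2) := rfl

/-- **The Sol lattice `Γ_B = ℤ² ⋊_B ℤ` as the affine group `⟨p ↦ p + e₁, p ↦ Bp⟩ ≤ Perm(ℤ × ℤ)`** (faithful: all maps `p ↦ Bᵏp + v`).
[cite: MilnorSolvableGrowth1968, p. 447] -/
abbrev Grp : Subgroup (Equiv.Perm (ℤ × ℤ)) := Subgroup.closure {transl, shear}

/-- The letters: `true ↦ (p ↦ Bp)`, `false ↦ (p ↦ Bp + e₁)`. [folklore] -/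
def letter (b : Bool) : Equiv.Perm (ℤ × ℤ) := if b then shear else shearTransl

/-- `B`-iterates of a point. [folklore] -/
def bpow : ℕ → ℤ × ℤ → ℤ × ℤ
  | 0, p => p
  | n + 1, p => (2 * (bpow n p).1 + (bpow n p).2, (bpow n p).1 + (bpow n p).2)

/-- The translation part `c_w` of a positive word (`c_{b::w} = B c_w + δ_b e₁`). [folklore] -/
def cvec : List Bool → ℤ × ℤ
  | [] => (0, 0)
  | b :: w => (2 * (cvec w).1 + (cvec w).2 + (if b then 0 else 1), (cvec w).1 + (cvec w).2)

/-- The maximal translation part `s_m = Σ_{i<m} Bⁱ e₁` (`s_{m+1} = B s_m + e₁`). [folklore] -/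
def svec : ℕ → ℤ × ℤ
  | 0 => (0, 0)
  | m + 1 => (2 * (svec m).1 + (svec m).2 + 1, (svec m).1 + (svec m).2)

/-- **A positive word acts by `p ↦ B^{|w|} p + c_w`.** [folklore] -/
theorem posWord_apply : ∀ (w : List Bool) (p : ℤ × ℤ), (w.map letter).prod p = bpow w.length p + cvec w
  | [], p => by simp [bpow, cvec]
  | b :: w, p => by
    rw [List.map_cons, List.prod_cons, Equiv.Perm.coe_mul, Function.comp_apply, posWord_apply w p, List.length_cons]
    cases b <;> ext <;> simp [letter, bpow, cvec] <;> ring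

/-- `B` fixes the origin. [folklore] -/
theorem bpow_zero_pt (n : ℕ) : bpow n (0, 0) = (0, 0) := by
  induction n with
  | zero => rfl
  | succ n ih => simp [bpow, ih]

/-- `0 ≤ c_w ≤ s_{|w|}` componentwise. [folklore] -/
theorem cvec_le_svec (w : List Bool) :
    0 ≤ (cvec w).1 ∧ 0 ≤ (cvec w).2 ∧ (cvec w).1 ≤ (svec w.length).1 ∧ (cvec w).2 ≤ (svec w.length).2 := by
  induction w with
  | nil => simp [cvec, svec]
  | cons b w ih =>
    obtain ⟨h1, h2, h3, h4⟩ := ih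
    simp only [cvec, svec, List.length_cons]
    cases b <;> simp only [Bool.false_eq_true, ↓reduceIte] <;> refine ⟨by omega, by omega, by omega, by omega⟩

/-- `s_m + e₁ ≤ Bᵐ e₁` componentwise (so `ℓ(c_w) < ℓ(B^{|w|} e₁)`), and `Bᵐ e₁ ≥ 0`. [folklore] -/
theorem svec_lt_bpow (m : ℕ) :
    (svec m).1 + 1 ≤ (bpow m (1, 0)).1 ∧ (svec m).2 ≤ (bpow m (1, 0)).2 ∧ 0 ≤ (svec m).1 ∧ 0 ≤ (svec m).2 := by
  induction m with
  | zero => simp [svec, bpow]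
  | succ m ih =>
    obtain ⟨h1, h2, h3, h4⟩ := ih
    simp only [svec, bpow]
    refine ⟨by omega, by omega, by omega, by omega⟩

/-- `ℓ(Bᵐ e₁)` (`ℓ(x,y) = x + y`) is strictly increasing in `m`. [folklore] -/
theorem ell_bpow_strictMono : StrictMono fun m => (bpow m (1, 0)).1 + (bpow m (1, 0)).2 := by
  refine strictMono_nat_of_lt_succ fun m => ?_
  obtain ⟨h1, h2, h3, h4⟩ := svec_lt_bpow m
  show (bpow m (1, 0)).1 + (bpow m (1, 0)).2 < (bpow (m + 1) (1, 0)).1 + (bpow (m + 1) (1, 0)).2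
  simp only [bpow]
  omega

/-- `c_{w ++ [b]} = c_w + δ_b B^{|w|} e₁` (the LAST letter carries the top digit). [folklore] -/
theorem cvec_append_singleton (w : List Bool) (b : Bool) :
    cvec (w ++ [b]) = (((cvec w).1 + if b then 0 else (bpow w.length (1, 0)).1), ((cvec w).2 + if b then 0 else (bpow w.length (1, 0)).2)) := by
  induction w with
  | nil => cases b <;> simp [cvec, bpow]
  | cons b₀ w ih =>
    rw [List.cons_append, cvec, ih, List.length_cons]
    cases b <;> cases b₀ <;> ext <;> simp [cvec, bpow] <;> ring

/-- **The digits are recovered**: words of equal length with equal translation part are equal. [folklore] -/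
theorem cvec_injective_of_length_eq : ∀ (n : ℕ) (w w' : List Bool), w.length = n → w'.length = n → cvec w = cvec w' → w = w' := by
  intro n
  induction n with
  | zero => intro w w' hw hw' _; rw [List.length_eq_zero_iff.1 hw, List.length_eq_zero_iff.1 hw']
  | succ n ih =>
    intro w w' hw hw' h
    obtain ⟨w₀, b, rfl⟩ := List.eq_nil_or_concat w |>.resolve_left (by rintro rfl; simp at hw)
    obtain ⟨w₀', b', rfl⟩ := List.eq_nil_or_concat w' |>.resolve_left (by rintro rfl; simp at hw')
    simp only [List.concat_eq_append] at hw hw' h ⊢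
    rw [List.length_append, List.length_singleton] at hw hw'
    have hl : w₀.length = n := by omega
    have hl' : w₀'.length = n := by omega
    rw [cvec_append_singleton, cvec_append_singleton, hl, hl'] at h
    obtain ⟨c1, c2, c3, c4⟩ := cvec_le_svec w₀
    obtain ⟨c1', c2', c3', c4'⟩ := cvec_le_svec w₀'
    obtain ⟨s1, s2, s3, s4⟩ := svec_lt_bpow n
    rw [hl] at c3 c4; rw [hl'] at c3' c4'
    have e1 := congrArg Prod.fst h
    have e2 := congrArg Prod.snd h
    simp only at e1 e2
    -- the top digit is decided by `ℓ`: with it, `ℓ ≥ ℓ(Bⁿe₁)`; without it, `ℓ < ℓ(Bⁿe₁)`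
    have hb : b = b' := by
      cases b <;> cases b' <;> simp only [Bool.false_eq_true, ↓reduceIte] at e1 e2 ⊢ <;> omega
    subst hb
    have hc : cvec w₀ = cvec w₀' := by
      cases b <;> simp only [Bool.false_eq_true, ↓reduceIte] at e1 e2 <;> ext <;> omega
    rw [ih w₀ w₀' hl hl' hc]

/-- **`p ↦ Bp` and `p ↦ Bp + e₁` generate a free submonoid**: positive words are pairwise distinct permutations. [cite: MilnorSolvableGrowth1968, p. 447] -/
theorem posWord_injective : Function.Injective fun w : List Bool => (w.map letter).prod := by
  intro w w' h
  have h' : (w.map letter).prod = (w'.map letter).prod := h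
  have h0 := congrArg (fun σ : Equiv.Perm (ℤ × ℤ) => σ (0, 0)) h'
  have h1 := congrArg (fun σ : Equiv.Perm (ℤ × ℤ) => σ (1, 0)) h'
  simp only [posWord_apply, bpow_zero_pt] at h0 h1
  rw [Prod.mk_zero_zero, zero_add, zero_add] at h0
  have hc : cvec w = cvec w' := by ext <;> [exact congrArg Prod.fst h0; exact congrArg Prod.snd h0]
  rw [hc] at h1
  have hb : bpow w.length (1, 0) = bpow w'.length (1, 0) := add_right_cancel h1
  have hlen : w.length = w'.length :=
    ell_bpow_strictMono.injective (by show (bpow w.length (1,0)).1 + (bpow w.length (1,0)).2 = _; rw [hb])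
  exact cvec_injective_of_length_eq _ w w' hlen rfl hc

/-- The letters lie in `Γ_B`. [folklore] -/
theorem letter_mem (b : Bool) : letter b ∈ Grp := by
  cases b
  · exact mul_mem (Subgroup.subset_closure (Set.mem_insert _ _)) (Subgroup.subset_closure (Set.mem_insert_of_mem _ rfl))
  · exact Subgroup.subset_closure (Set.mem_insert_of_mem _ rfl)

/-- The free pair inside `Γ_B` (as elements of the subgroup type). [folklore] -/
theorem posWord_injective_grp :
    Function.Injective fun w : List Bool => (w.map fun b => if b then (⟨shear, letter_mem true⟩ : Grp) else ⟨shearTransl, letter_mem false⟩).prod := by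
  intro w w' h
  apply posWord_injective
  have key : ∀ w : List Bool,
      (((w.map fun b => if b then (⟨shear, letter_mem true⟩ : Grp) else ⟨shearTransl, letter_mem false⟩).prod : Grp) : Equiv.Perm (ℤ × ℤ)) =
        (w.map letter).prod := by
    intro w
    rw [SubmonoidClass.coe_list_prod, List.map_map]
    congr 1
    apply List.map_congr_left
    intro b _
    cases b <;> rfl
  have h' := congrArg (fun x : Grp => (x : Equiv.Perm (ℤ × ℤ))) h
  simp only [key] at h'
  exact h'

/-- **Every Cayley graph of the Sol lattice `Γ_B` has exponential growth.** [cite: MilnorSolvableGrowth1968, p. 447] [cite: LyonsPeres2016, §7.4 Thm. 7.20] -/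
theorem hasExponentialGrowth_anyGens (S : Finset Grp) (hS : Subgroup.closure (S : Set Grp) = ⊤) :
    Literature.Barriers.CriticalPhenomena.HasExponentialGrowth (mulCayley (↑S : Set Grp)) :=
  FreePair.hasExponentialGrowth S hS posWord_injective_grp

/-- **THEOREM (unconditional, kernel): `θ_g(p_c) = 0` on every Cayley graph of the Sol lattice `ℤ² ⋊_B ℤ`** — every finite generating set, every
vertex (the class map's first POLYCYCLIC non-virtually-nilpotent customer; `b₁ = 1`, not on the wall). [cite: Hutchcroft2016, Thm. 1]
[cite: BenjaminiSchramm1996, Conj. 4; §2 (Cayley graphs)] -/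
theorem criticalContinuity_anyGens (S : Finset Grp) (hS : Subgroup.closure (S : Set Grp) = ⊤) (g : Grp) :
    theta (mulCayley (↑S : Set Grp)) g (criticalProbIOf (mulCayley (↑S : Set Grp)) g) = 0 :=
  FreePair.criticalContinuity S hS posWord_injective_grp g

end SolB

end Summit.CriticalPhenomena.PercolationContinuityZ3.Theorems.Transplant
end
-- build-touch 2026-08-25T07:46:31Z T1-B (lead g18): re-land of p391380, declarations byte-identical
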